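import Mathlib
import HarnessLib
import Literature.NumberTheory.GaloisRepresentations.GlobalTriangulineSpace

/-!
# Fern span criteria for the tangent spaces `T_L ⊆ H¹(Γ_K, ad ρ)` (crux `ProModularOfGKBound`, helpers)

Route `EisensteinGelfandKirillov`, crux stmt-Langlands-18273 (`ProModularOfGKBound`).  Kernel-checked forms
of the two linear-algebra criteria that the crux idea cards `eisenstein-fern` (ideator 1, "fernSpanCriterion")
and `two-leaf-fern` (ideator 2, "twoLeaf_span") isolate as their first lemmas, stated over the tree's
vocabulary `Literature.NumberTheory.GaloisRepresentations.GlobalTriangulineSpace`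
(`FramedGaloisRep.tangentSpaceWith`, `tangentObstructionMap`, `TangentObstructionSurjective`,
`adjointHUnramifiedOutside`, `adjointLoc`):

* `tangentSpaceWith_mono`, `tangentSpaceWith_inf`, `tangentSpaceWith_top` — the tangent space is monotone
  in the local conditions, turns `⊓` of local conditions into `⊓` of tangent spaces, and is all of
  `H¹_S(Γ_K, ad ρ)` when no condition is imposed;
* `fernSpanCriterion` — if the tangent–obstruction map for the INTERSECTED conditions `L_α ⊓ L_β` is
  surjective (dual-Selmer vanishing) and the local conditions span, `L_α,v ⊔ L_β,v = ⊤` for every `v`,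
  then the two global tangent spaces span `H¹_S(Γ_K, ad ρ)` (Chenevier's infinite-fern accumulation step,
  [Chenevier, Ann. Sci. ÉNS 44 (2011), Thm C / §3]; Bellaïche–Chenevier, Astérisque 324, §7.6.1);
* `twoLeaf_span` — the dimension-count form: `T_{L ⊓ L'} = 0` and `dim T_L + dim T_{L'} = dim T_⊤ < ∞`
  force `T_L ⊔ T_{L'} = T_⊤`.

Pure (sub)module algebra over a commutative coefficient ring `A` (a field `E` for the dimension count);
no arithmetic input.  These lemmas support the crux item; they do not close it.

References: G. Chenevier, *On the infinite fern of Galois representations of unitary type*,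
Ann. Sci. ÉNS 44 (2011), Thm C, §3; J. Bellaïche, G. Chenevier, *Families of Galois representations
and Selmer groups*, Astérisque 324 (2009), §7.6.1.
-/

set_option linter.dupNamespace false -- `Summit.Langlands.Langlands.Theorems` is the mandated Theorems namespace (summit = problem name)

namespace Summit.Langlands.Langlands.Theorems

open Literature.NumberTheory.GaloisRepresentations IsDedekindDomain
open scoped NumberField

universe u

variable {K : Type u} [Field K] [NumberField K] {A : Type u} [CommRing A] [TopologicalSpace A]
  [IsTopologicalRing A] {n : ℕ} {Sp : Set (HeightOneSpectrum (𝓞 K))}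

/-- The tangent space is monotone in the local conditions: `L ≤ L'` placewise gives `T_L ≤ T_{L'}`.
[folklore] -/
theorem tangentSpaceWith_mono (S : Set (HeightOneSpectrum (𝓞 K))) (ρ : FramedGaloisRep K A n)
    {L L' : ∀ v : Sp, Submodule A ((FramedRep.adjoint (ρ.toLocal v.1)).H 1)} (h : ∀ v, L v ≤ L' v) :
    ρ.tangentSpaceWith S L ≤ ρ.tangentSpaceWith S L' := by
  intro c hc
  rw [FramedGaloisRep.mem_tangentSpaceWith_iff] at hc ⊢
  exact ⟨hc.1, fun v => h v (hc.2 v)⟩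

/-- The tangent space of the intersected local conditions is the intersection of the tangent spaces:
`T_{L ⊓ L'} = T_L ⊓ T_{L'}`. [folklore] -/
theorem tangentSpaceWith_inf (S : Set (HeightOneSpectrum (𝓞 K))) (ρ : FramedGaloisRep K A n)
    (L L' : ∀ v : Sp, Submodule A ((FramedRep.adjoint (ρ.toLocal v.1)).H 1)) :
    ρ.tangentSpaceWith S (fun v => L v ⊓ L' v) = ρ.tangentSpaceWith S L ⊓ ρ.tangentSpaceWith S L' := by
  ext c
  simp only [Submodule.mem_inf, FramedGaloisRep.mem_tangentSpaceWith_iff]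
  constructor
  · rintro ⟨hS, hloc⟩
    exact ⟨⟨hS, fun v => (hloc v).1⟩, ⟨hS, fun v => (hloc v).2⟩⟩
  · rintro ⟨⟨hS, h₁⟩, ⟨-, h₂⟩⟩
    exact ⟨hS, fun v => ⟨h₁ v, h₂ v⟩⟩

/-- With no local condition (`L_v = ⊤`) the tangent space is all of `H¹_S(Γ_K, ad ρ)`. [folklore] -/
theorem tangentSpaceWith_top (S : Set (HeightOneSpectrum (𝓞 K))) (ρ : FramedGaloisRep K A n) :
    ρ.tangentSpaceWith S (Sp := Sp) (fun _ => ⊤) = ρ.adjointHUnramifiedOutside S 1 := by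
  ext c
  simp only [FramedGaloisRep.mem_tangentSpaceWith_iff, Submodule.mem_top, implies_true, and_true]

/-- Every tangent space lies in `H¹_S(Γ_K, ad ρ)`. [folklore] -/
theorem tangentSpaceWith_le (S : Set (HeightOneSpectrum (𝓞 K))) (ρ : FramedGaloisRep K A n)
    (L : ∀ v : Sp, Submodule A ((FramedRep.adjoint (ρ.toLocal v.1)).H 1)) :
    ρ.tangentSpaceWith S L ≤ ρ.adjointHUnramifiedOutside S 1 := fun _ hc =>
  ((FramedGaloisRep.mem_tangentSpaceWith_iff S ρ L _).1 hc).1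

/-- **Fern span criterion** (Chenevier's accumulation step in `H¹`).  If the tangent–obstruction map
`H¹_S(Γ_K, ad ρ) → Π_v H¹(Γ_{K_v}, ad ρ_v) ⧸ (L_α,v ⊓ L_β,v)` is surjective and the local conditions span,
`L_α,v ⊔ L_β,v = ⊤` for all `v ∈ Sp`, then `T_{L_α} ⊔ T_{L_β} = H¹_S(Γ_K, ad ρ)`: given a class `c`, write
`loc_v c = a_v + b_v` with `a_v ∈ L_α,v`, `b_v ∈ L_β,v`, lift `(a_v)_v` modulo `L_α ⊓ L_β` to a global class `d`
(surjectivity); then `d ∈ T_{L_α}` and `c - d ∈ T_{L_β}`.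
[cite: Chenevier2011, Thm C and §3] -/
theorem fernSpanCriterion (S : Set (HeightOneSpectrum (𝓞 K))) (ρ : FramedGaloisRep K A n)
    (Lα Lβ : ∀ v : Sp, Submodule A ((FramedRep.adjoint (ρ.toLocal v.1)).H 1))
    (hsurj : ρ.TangentObstructionSurjective S (fun v => Lα v ⊓ Lβ v))
    (hloc : ∀ v, Lα v ⊔ Lβ v = ⊤) :
    ρ.tangentSpaceWith S Lα ⊔ ρ.tangentSpaceWith S Lβ = ρ.adjointHUnramifiedOutside S 1 := by
  refine le_antisymm (sup_le (tangentSpaceWith_le S ρ Lα) (tangentSpaceWith_le S ρ Lβ)) ?_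
  intro c hc
  -- local decompositions `loc_v c = a_v + b_v`
  have hdec : ∀ v : Sp, ∃ a ∈ Lα v, ∃ b ∈ Lβ v, a + b = ρ.adjointLoc v.1 1 c := fun v => by
    have h : ρ.adjointLoc v.1 1 c ∈ Lα v ⊔ Lβ v := by rw [hloc v]; exact Submodule.mem_top
    exact Submodule.mem_sup.1 h
  choose a ha b hb hab using hdec
  -- lift `(a_v mod L_α ⊓ L_β)_v` to a global class `d ∈ H¹_S`
  obtain ⟨d, hd⟩ := hsurj fun v => (Lα v ⊓ Lβ v).mkQ (a v)
  have hdv : ∀ v : Sp, ρ.adjointLoc v.1 1 (d : ρ.adjoint.H 1) - a v ∈ Lα v ⊓ Lβ v := by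
    intro v
    have h := congrFun hd v
    rw [FramedGaloisRep.tangentObstructionMap_apply, Submodule.mkQ_apply, Submodule.mkQ_apply,
      Submodule.Quotient.eq] at h
    exact h
  have hdα : (d : ρ.adjoint.H 1) ∈ ρ.tangentSpaceWith S Lα := by
    rw [FramedGaloisRep.mem_tangentSpaceWith_iff]
    refine ⟨d.2, fun v => ?_⟩
    have := (Lα v).add_mem (hdv v).1 (ha v)
    rwa [sub_add_cancel] at this
  have hcdβ : c - (d : ρ.adjoint.H 1) ∈ ρ.tangentSpaceWith S Lβ := by
    rw [FramedGaloisRep.mem_tangentSpaceWith_iff]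
    refine ⟨(ρ.adjointHUnramifiedOutside S 1).sub_mem hc d.2, fun v => ?_⟩
    have e : ρ.adjointLoc v.1 1 (c - (d : ρ.adjoint.H 1)) =
        b v - (ρ.adjointLoc v.1 1 (d : ρ.adjoint.H 1) - a v) := by
      rw [map_sub, ← hab v]; abel
    rw [e]
    exact (Lβ v).sub_mem (hb v) (hdv v).2
  have e : c = (d : ρ.adjoint.H 1) + (c - (d : ρ.adjoint.H 1)) := by abel
  rw [e]
  exact Submodule.add_mem_sup hdα hcdβ

/-- **Two-leaf spanning criterion** (dimension-count form, coefficients a field `E`): if the tangent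
spaces of two families of local conditions meet trivially, `T_{L ⊓ L'} = 0`, and their dimensions add up
to that of the finite-dimensional ambient tangent space `T_⊤ = H¹_S(Γ_K, ad ρ)`, then they span it:
`T_L ⊔ T_{L'} = T_⊤` (Grassmann's formula). [folklore] -/
theorem twoLeaf_span {E : Type u} [Field E] [TopologicalSpace E] [IsTopologicalRing E]
    (S : Set (HeightOneSpectrum (𝓞 K))) (ρ : FramedGaloisRep K E n)
    (L L' : ∀ v : Sp, Submodule E ((FramedRep.adjoint (ρ.toLocal v.1)).H 1))
    [FiniteDimensional E (ρ.tangentSpaceWith S (Sp := Sp) (fun _ => ⊤))]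
    (hcap : ρ.tangentSpaceWith S (fun v => L v ⊓ L' v) = ⊥)
    (hdim : Module.finrank E (ρ.tangentSpaceWith S L) + Module.finrank E (ρ.tangentSpaceWith S L')
        = Module.finrank E (ρ.tangentSpaceWith S (Sp := Sp) (fun _ => ⊤))) :
    ρ.tangentSpaceWith S L ⊔ ρ.tangentSpaceWith S L'
      = ρ.tangentSpaceWith S (Sp := Sp) (fun _ => ⊤) := by
  have hL : ρ.tangentSpaceWith S L ≤ ρ.tangentSpaceWith S (Sp := Sp) (fun _ => ⊤) :=
    tangentSpaceWith_mono S ρ fun _ => le_top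
  have hL' : ρ.tangentSpaceWith S L' ≤ ρ.tangentSpaceWith S (Sp := Sp) (fun _ => ⊤) :=
    tangentSpaceWith_mono S ρ fun _ => le_top
  haveI : FiniteDimensional E (ρ.tangentSpaceWith S L) := Submodule.finiteDimensional_of_le hL
  haveI : FiniteDimensional E (ρ.tangentSpaceWith S L') := Submodule.finiteDimensional_of_le hL'
  have hinf : ρ.tangentSpaceWith S L ⊓ ρ.tangentSpaceWith S L' = ⊥ := by
    rw [← tangentSpaceWith_inf, hcap]
  refine Submodule.eq_of_le_of_finrank_eq (sup_le hL hL') ?_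
  have h := Submodule.finrank_sup_add_finrank_inf_eq (ρ.tangentSpaceWith S L) (ρ.tangentSpaceWith S L')
  rw [hinf, finrank_bot, add_zero] at h
  rw [h, hdim]

end Summit.Langlands.Langlands.Theorems
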